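import Literature.Probability.RandomPlanarGeometry.SAWHalfSpacePieces
import Literature.Probability.RandomPlanarGeometry.SAWReflect
import HarnessLib

/-!
# Half-space pieces: symmetry in the endpoint direction, and the count against `c_m(0,e)` (`ℤ^d`)

Topic `Literature/Probability/RandomPlanarGeometry` (continues `SAWHalfSpacePieces.lean`: `HalfSpacePieces.countAt_le_sum_card_halfSpace`,
the re-rooting count over all endpoint directions `τ e_j`, `j ≠ k`; `SAWReflect.lean`: the reflections `Zd.reflAt`).

Source: N. Madras, G. Slade, *The Self-Avoiding Walk* (1993), §1.1 (the symmetries of `ℤ^d` act on self-avoiding walks) and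
§3.2, eqs. (3.2.3)–(3.2.4) ("by symmetry, all of the classes have the same cardinality").  The hyperoctahedral maps that fix
the coordinate `k` — the sign change of a coordinate `j ≠ k` and the transposition of two coordinates `j, j' ≠ k` — map the
half-space pieces `{η : 0 → τ e_j, s η_k ≥ 0}` bijectively onto each other; hence every such family is at least
`c_m(0,e) / (4 d (m+1))`.

* `HalfSpacePieces.card_filter_le_of_map` — transport of half-space pieces under a lattice symmetry fixing the coordinate `k`;
* `HalfSpacePieces.card_halfSpace_eq` — the families for `τ e_j` and `t e_{k'}` (`j, k' ≠ k`) are equinumerous;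
* **`HalfSpacePieces.countAt_le_card_halfSpace`** — `c_m(0,e) ≤ 4 d (m+1) · #{η ∈ sawFun d m (t e_{k'}) : s η_k ≥ 0}` for
  `m ≥ 2`, `k' ≠ k`, signs `s, t`, `e ~ 0`.
-/

noncomputable section

open Finset Literature.Probability.LatticeModels SimpleGraph

namespace Literature.Probability.RandomPlanarGeometry.SAW.Zd

namespace HalfSpacePieces

variable {d : ℕ}

/-! ### Transport under a symmetry fixing the coordinate `k` -/

open Classical in
/-- **Transport of half-space pieces** under a map `g` of `ℤ^d` that fixes the origin and the `k`-th coordinate, preserves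
nearest-neighbour steps and is injective. [cite: MadrasSlade1993, §1.1 (lattice symmetries act on self-avoiding walks)] -/
theorem card_filter_le_of_map {m : ℕ} {k : Fin d} {s : ℤ} {w : Site d} (g : Site d → Site d) (hg0 : g 0 = 0)
    (hgadj : ∀ a b, (zdGraph d).Adj a b → (zdGraph d).Adj (g a) (g b)) (hginj : Function.Injective g)
    (hgk : ∀ y, g y k = y k) :
    ((sawFun d m w).filter fun η => ∀ i ≤ m, 0 ≤ s * η i k).card ≤
      ((sawFun d m (g w)).filter fun η => ∀ i ≤ m, 0 ≤ s * η i k).card := by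
  refine Finset.card_le_card_of_injOn (fun η i => g (η i)) (fun η hη => ?_) ?_
  · rw [Finset.mem_coe, Finset.mem_filter] at hη ⊢
    obtain ⟨hηs, hcons⟩ := hη
    obtain ⟨h0, hend, hadj, hinj⟩ := mem_sawFun.1 hηs
    refine ⟨mem_sawFun.2 ⟨by simp [h0, hg0], fun i hi => by simp [hend i hi], fun i hi => hgadj _ _ (hadj i hi),
      fun a ha b hb hab => hinj ha hb (hginj hab)⟩, fun i hi => ?_⟩
    simp only [hgk]; exact hcons i hi
  · intro η₁ _ η₂ _ h
    funext i
    exact hginj (congrFun h i)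

/-- The sign change of the coordinate `j`: `0 ↦ 0`. [folklore] -/
private theorem reflAt_zero (j : Fin d) : reflAt j 0 (0 : Site d) = 0 := by
  funext l
  by_cases h : l = j
  · subst h; simp
  · simp [h]

/-- The sign change of the coordinate `j` on `τ e_j`. [folklore] -/
private theorem reflAt_single (j : Fin d) (τ : ℤ) : reflAt j 0 (Pi.single j τ : Site d) = Pi.single j (-τ) := by
  funext l
  by_cases h : l = j
  · subst h; simp
  · simp [h]

/-- Precomposition with a permutation of the coordinates. [folklore] -/
private def permSite (σ : Equiv.Perm (Fin d)) (y : Site d) : Site d := fun l => y (σ l)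

/-- `Pi.single` under a permutation of the coordinates. [folklore] -/
private theorem permSite_single (σ : Equiv.Perm (Fin d)) (i : Fin d) (a : ℤ) :
    permSite σ (Pi.single i a) = Pi.single (σ.symm i) a := by
  funext l
  simp only [permSite, Pi.single_apply, Equiv.eq_symm_apply]

/-- Permutations of the coordinates preserve nearest-neighbour steps. [cite: MadrasSlade1993, §1.1 (lattice symmetries)] -/
private theorem adj_permSite (σ : Equiv.Perm (Fin d)) {a b : Site d} (h : (zdGraph d).Adj a b) :
    (zdGraph d).Adj (permSite σ a) (permSite σ b) := by
  rw [zdGraph_adj_iff] at h ⊢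
  obtain ⟨i, h | h⟩ := h
  · refine ⟨σ.symm i, Or.inl ?_⟩
    rw [h, ← permSite_single]; rfl
  · refine ⟨σ.symm i, Or.inr ?_⟩
    rw [h, ← permSite_single]; rfl

/-- Permutations of the coordinates are injective on sites. [folklore] -/
private theorem permSite_injective (σ : Equiv.Perm (Fin d)) : Function.Injective (permSite (d := d) σ) := by
  intro y y' h
  funext l
  have := congrFun h (σ.symm l)
  simpa [permSite] using this

/-! ### Equinumerosity of the endpoint directions -/

open Classical in
/-- **All half-space piece families `{η : 0 → τ e_j, s η_k ≥ 0}` with `j ≠ k` are at most the one for `t e_{k'}`** (`k' ≠ k`):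
transposition `j ↔ k'` followed, if needed, by the sign change of the coordinate `k'`.
[cite: MadrasSlade1993, §3.2, after (3.2.4) ("by symmetry, all of the classes have the same cardinality")] -/
theorem card_halfSpace_le {m : ℕ} {k j k' : Fin d} (hj : j ≠ k) (hk' : k' ≠ k) {s τ t : ℤ}
    (hτ : τ = 1 ∨ τ = -1) (ht : t = 1 ∨ t = -1) :
    ((sawFun d m (Pi.single j τ)).filter fun η => ∀ i ≤ m, 0 ≤ s * η i k).card ≤
      ((sawFun d m (Pi.single k' t)).filter fun η => ∀ i ≤ m, 0 ≤ s * η i k).card := by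
  -- transposition `j ↔ k'`
  set σ : Equiv.Perm (Fin d) := Equiv.swap j k' with hσ
  have hσk : σ k = k := Equiv.swap_apply_of_ne_of_ne hj.symm hk'.symm
  have h1 := card_filter_le_of_map (m := m) (k := k) (s := s) (w := Pi.single j τ) (permSite σ)
    (by funext l; simp [permSite]) (fun a b h => adj_permSite σ h) (permSite_injective σ)
    (fun y => by simp only [permSite, hσk])
  have e1 : permSite σ (Pi.single j τ : Site d) = Pi.single k' τ := by
    rw [permSite_single, hσ, Equiv.symm_swap, Equiv.swap_apply_left]
  rw [e1] at h1
  refine h1.trans ?_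
  by_cases hτt : τ = t
  · rw [hτt]
  · -- sign change of the coordinate `k'`
    have hτt' : -τ = t := by rcases hτ with rfl | rfl <;> rcases ht with rfl | rfl <;> simp_all
    have h2 := card_filter_le_of_map (m := m) (k := k) (s := s) (w := Pi.single k' τ) (reflAt k' 0)
      (reflAt_zero k') (fun a b h => zdGraph_adj_reflAt_of_adj k' 0 h) (reflAt_injective k' 0)
      (fun y => reflAt_apply_of_ne hk'.symm 0 y)
    rw [reflAt_single, hτt'] at h2
    exact h2

/-! ### The count against `c_m(0,e)` -/

open Classical in
/-- **Half-space pieces ending at a prescribed `t e_{k'}` are at least `c_m(0,e)/(4 d (m+1))`**: for `m ≥ 2`, `k' ≠ k`, signs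
`s, t` and a neighbour `e` of the origin, `c_m(0,e) ≤ 4 d (m+1) · #{η ∈ sawFun d m (t e_{k'}) : ∀ i ≤ m, 0 ≤ s η(i)_k}`.
[cite: MadrasSlade1993, §3.2, eqs. (3.2.1), (3.2.3)–(3.2.4); Corollary 3.2.6 (proof)] -/
theorem countAt_le_card_halfSpace {m : ℕ} {e : Site d} (he : (zdGraph d).Adj 0 e) (hm : 2 ≤ m) {k k' : Fin d}
    (hk' : k' ≠ k) {s t : ℤ} (hs : s = 1 ∨ s = -1) (ht : t = 1 ∨ t = -1) :
    countAt d m e ≤ 4 * d * (m + 1) * ((sawFun d m (Pi.single k' t)).filter fun η => ∀ i ≤ m, 0 ≤ s * η i k).card := by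
  set F := ((sawFun d m (Pi.single k' t)).filter fun η => ∀ i ≤ m, 0 ≤ s * η i k).card with hF
  have h1 := countAt_le_sum_card_halfSpace he hm k hs
  have h2 : ∑ p ∈ dirs d k, ((sawFun d m (Pi.single p.1 p.2)).filter fun η => ∀ i ≤ m, 0 ≤ s * η i k).card ≤
      (dirs d k).card * F := by
    rw [← smul_eq_mul, ← Finset.sum_const]
    refine Finset.sum_le_sum fun p hp => ?_
    obtain ⟨hj, hτ⟩ := mem_dirs.1 hp
    exact card_halfSpace_le hj hk' hτ ht
  have h3 := card_dirs_le d k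
  calc countAt d m e ≤ 2 * (m + 1) * ∑ p ∈ dirs d k,
        ((sawFun d m (Pi.single p.1 p.2)).filter fun η => ∀ i ≤ m, 0 ≤ s * η i k).card := h1
    _ ≤ 2 * (m + 1) * ((dirs d k).card * F) := Nat.mul_le_mul_left _ h2
    _ ≤ 2 * (m + 1) * (2 * d * F) := Nat.mul_le_mul_left _ (Nat.mul_le_mul_right _ h3)
    _ = 4 * d * (m + 1) * F := by ring

end HalfSpacePieces

end Literature.Probability.RandomPlanarGeometry.SAW.Zd
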